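import Literature.AlgebraicGeometry.AbelianSchemes.AbelianSchemeOverGlueDataPolarizationNormalized
import Literature.AlgebraicGeometry.AbelianSchemes.PolarizedTripleRigidity
import HarnessLib

/-!
# Gluing polarised triples along a cocycle of the base FROM SLICE TRIPLES AND PAIRWISE TRANSITION RELATIONS
# (the F-8 (8c) entrance of hand (h7); `θᵢᵢ = 𝟙` by triple rigidity)

Topic `AlgebraicGeometry/AbelianSchemes`; namespace `Literature.AlgebraicGeometry.AbelianSchemes.PolarizedAbelianSchemeWithLevel`.
Cell hodgecm-mathlib (D-0151), hand (h7)(D-F3), consumer F-8 (8c) «the universal family over the glued moduli scheme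
`A⁰ = ⋃ V_R`: restrictions of ONE polarised family along open immersions + the transition ISOMORPHISMS OF TRIPLES» (price
sheet §3 F-8).  Two definitions with bodies (`cocycleDatumOfTriples`, `glueTripleOfTriples`), theorems otherwise; no
instance, no notation, no `sorry`.

INPUT, in the consumer's own words: glue data `D` of the base; a TRIPLE `Pᵢ = (Aᵢ, (Âᵢ, 𝒫ᵢ), λᵢ, φᵢ)` over every slice
`D.U i` (★ `PolarizedAbelianSchemeWithLevel g N δ (D.U i)`); for every `i j` maps `θ i j`, `θ̂ i j` of the restricted
families / duals over `D.t i j` forming a TRANSITION RELATION OF TRIPLES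
`R i j : (Pᵢ|_{V(i,j)}).IsBaseChangeVia (Pⱼ|_{V(j,i)}) (D.t i j) (θ i j) (θ̂ i j)` (★ `PolarizedAbelianSchemeWithLevel.baseChange`,
all five clauses of [MumfordFogartyKirwan1994, Def. 7.2]); the cocycle condition `hcoc` on triple overlaps in ★ B-p04's
`relativeT'` currency (its two rigidity sockets ★ `relativeT'_cocycle_relativeToBase` / `relativeT'_cocycle_iff` are the
consumer's road to it); the field-level rigidity hypothesis (FB_Ω) of ★ `PolarizedTripleRigidity` («triples over
algebraically closed fields have no automorphisms», [MumfordFogartyKirwan1994, Ch. 7 §3 lemma of Serre]; consumed as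
stated there); and ANY dual pair `D₀` of the glued family.  OUTPUT:

* §1 **`θ_self_eq_id`** — `θ i i = 𝟙`: `R i i` is a self-relation of the triple `Pᵢ|_{V(i,i)}` along `D.t i i = 𝟙`
  (Mathlib `Scheme.GlueData.t_id`), hence trivial by ★ `eq_id_of_isBaseChangeVia_id_of_forall_geometricPoint`;
* §2 **`cocycleDatumOfTriples : CocycleDatum D`** (★ FILE 5; `A i := (P i).A`, `θ`, `hθ := (R i j).1.1`, `hθid := §1`, `hcoc`)
  and the FILE C inputs READ OFF the relations: `hθhat := (R i j).2.2.1` (Poincaré), `hlam := (R i j).2.2.2` (`λ`),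
  `hφ := (R i j).1` (level) — definitionally the base-changed components (★ `baseChange_A/_D/_pol/_level` are `rfl`);
* §3 **`glueTripleOfTriples : PolarizedAbelianSchemeWithLevel g N δ D.glued`** over reduced locally Noetherian slices, for
  ANY `D₀` (★ FILE H road: `D₀.normalize`, chart unit hypotheses from the `λᵢ`), with `glueTripleOfTriples_A` and
  CARTESIAN CHARTS **`isBaseChangeVia_glueTripleOfTriples i : (P i).IsBaseChangeVia glueTripleOfTriples (D.ι i) (ιᵢ) (Ĝᵢ)`**
  (★ FILE H `isBaseChangeVia_chartTriple_normalize`; `chartTriple … i = P i` by structure eta).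

HC_CM is proved only modulo the printed citations until rung 0 closes; this file discharges none of them.

## References
* [MumfordFogartyKirwan1994] D. Mumford, J. Fogarty, F. Kirwan, *Geometric Invariant Theory*, 3rd ed. (1994), Ch. 7 §2
  Def. 7.2 (p. 129), Def. 7.3 (p. 129); §3, remark after Thm. 7.9 (p. 139) (lemma of Serre).
* [StacksProject] The Stacks Project, Tag 01LH (Relative glueing).
* [MilneAV2008] J. S. Milne, *Abelian Varieties* (v2.00, 2008), I §8 pp. 36–37.
-/

universe u

open CategoryTheory CategoryTheory.Limits AlgebraicGeometry MonoidalCategory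
open Literature.AlgebraicGeometry.Morphisms

noncomputable section

namespace Literature.AlgebraicGeometry.AbelianSchemes

namespace PolarizedAbelianSchemeWithLevel

open AbelianSchemeOver
open Literature.AlgebraicGeometry.ModuliOfAbelianVarieties (IsPolarizationType)
open scoped MonObj

variable {g N : ℕ} {δ : Fin g → ℕ} {D : Scheme.GlueData.{u}}
  (P : ∀ i : D.J, PolarizedAbelianSchemeWithLevel g N δ (D.U i))
  (θ : ∀ i j, pullback (P i).A.X.hom (D.f i j) ⟶ pullback (P j).A.X.hom (D.f j i))
  (θhat : ∀ i j, ((P i).D.baseChange (D.f i j)).hat.X.left ⟶ ((P j).D.baseChange (D.f j i)).hat.X.left)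
  (R : ∀ i j, ((P i).baseChange (D.f i j)).IsBaseChangeVia ((P j).baseChange (D.f j i)) (D.t i j) (θ i j) (θhat i j))
  (hΩ : ∀ ⦃Ω : Type u⦄ [Field Ω] [IsAlgClosed Ω] (Q : PolarizedAbelianSchemeWithLevel g N δ (Spec (.of Ω)))
    (H : Q.A.X.left ⟶ Q.A.X.left) (Ĥ : Q.D.hat.X.left ⟶ Q.D.hat.X.left), Q.IsBaseChangeVia Q (𝟙 _) H Ĥ → H = 𝟙 _)

/-! ### §1 `θᵢᵢ = 𝟙` by triple rigidity -/

include R hΩ in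
/-- **`θ i i = 𝟙`**: the transition relation `R i i` is a self-relation of the triple `Pᵢ|_{V(i,i)}` along
`D.t i i = 𝟙` (Mathlib `Scheme.GlueData.t_id`); triples are rigid (★ `eq_id_of_isBaseChangeVia_id_of_forall_geometricPoint`
under the field-level hypothesis `hΩ`, over the locally Noetherian `V(i,i)`). [cite: MumfordFogartyKirwan1994, Ch. 7 §3, remark after Theorem 7.9 (p. 139) («lemma of Serre»)]
[cite: MumfordFogartyKirwan1994, Ch. 7 §2 Definition 7.2 (p. 129)] -/
theorem θ_self_eq_id [∀ i, IsLocallyNoetherian (D.U i)] (i : D.J) : θ i i = 𝟙 _ := by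
  haveI : IsLocallyNoetherian (D.V (i, i)) := isLocallyNoetherian_of_isOpenImmersion (D.f i i)
  have h : ((P i).baseChange (D.f i i)).IsBaseChangeVia ((P i).baseChange (D.f i i)) (𝟙 _) (θ i i) (θhat i i) :=
    (congrArg (fun x => ((P i).baseChange (D.f i i)).IsBaseChangeVia ((P i).baseChange (D.f i i)) x (θ i i) (θhat i i))
      (D.t_id i)).mp (R i i)
  exact ((P i).baseChange (D.f i i)).eq_id_of_isBaseChangeVia_id_of_forall_geometricPoint (fun Ω _ _ _ => @hΩ Ω _ _) h

/-! ### §2 The cocycle datum of abelian schemes and the transition inputs read off the relations -/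

variable (hcoc : ∀ i j k,
    relativeT' D (fun i => (P i).A.X.left) (fun i => (P i).A.X.hom) θ (fun i j => (R i j).1.1.fst) i j k ≫
      relativeT' D (fun i => (P i).A.X.left) (fun i => (P i).A.X.hom) θ (fun i j => (R i j).1.1.fst) j k i ≫
        relativeT' D (fun i => (P i).A.X.left) (fun i => (P i).A.X.hom) θ (fun i j => (R i j).1.1.fst) k i j = 𝟙 _)

/-- **The ★ FILE 5 `CocycleDatum` of abelian schemes from the slice triples and the transition relations** (the
`A`-squares `(R i j).1.1`, `θᵢᵢ = 𝟙` from §1, the cocycle `hcoc`). [cite: StacksProject, Tag 01LH]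
[cite: MumfordFogartyKirwan1994, Ch. 7 §2 Definition 7.2 (p. 129)] -/
def cocycleDatumOfTriples [∀ i, IsLocallyNoetherian (D.U i)] : CocycleDatum D where
  A i := (P i).A
  θ := θ
  hθ i j := (R i j).1.1
  hθid := θ_self_eq_id P θ θhat R hΩ
  hcoc := hcoc

/-- The slices of `cocycleDatumOfTriples` are the `Aᵢ` (definitional). [cite: StacksProject, Tag 01LH] -/
theorem cocycleDatumOfTriples_A [∀ i, IsLocallyNoetherian (D.U i)] (i : D.J) :
    (cocycleDatumOfTriples P θ θhat R hΩ hcoc).A i = (P i).A := rfl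

/-- Its transition maps are the `θ i j` (definitional). [cite: StacksProject, Tag 01LH] -/
theorem cocycleDatumOfTriples_θ [∀ i, IsLocallyNoetherian (D.U i)] :
    (cocycleDatumOfTriples P θ θhat R hΩ hcoc).θ = θ := rfl

/-! ### §3 The glued triple over `A⁰ = D.glued` and its cartesian charts -/

variable [∀ i, IsLocallyNoetherian (D.U i)] [∀ i, IsReduced (D.U i)]
  (D₀ : (cocycleDatumOfTriples P θ θhat R hΩ hcoc).abelianScheme.DualPair) (hδ : IsPolarizationType δ)

/-- **THE GLUED TRIPLE FROM SLICE TRIPLES + TRANSITION RELATIONS + ANY DUAL PAIR OF THE GLUED FAMILY**, over reduced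
locally Noetherian slices (★ FILE C `glueTriple` on the FILE C inputs read off the `R i j`, with `D₀.normalize` and the
chart unit hypotheses from the `λᵢ` as in ★ FILE H). [cite: MumfordFogartyKirwan1994, Ch. 7 §2 Definition 7.2 (p. 129)]
[cite: StacksProject, Tag 01LH] [cite: MilneAV2008, I §8 pp. 36–37] -/
def glueTripleOfTriples : PolarizedAbelianSchemeWithLevel g N δ D.glued :=
  (cocycleDatumOfTriples P θ θhat R hΩ hcoc).glueTriple (fun i => (P i).D) (fun i => (P i).pol) θhat
    (fun i j => (R i j).2.2.1) (fun i j => (R i j).2.2.2) D₀.normalize (fun i => (P i).level) (fun i j => (R i j).1)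
    (fun i => (P i).relDim) hδ (fun i => (P i).hasType) (fun i => (P i).symplectic)
    D₀.nonempty_unitHatSlice_iso_normalize
    ((cocycleDatumOfTriples P θ θhat R hΩ hcoc).unit_of_isReduced (fun i => (P i).D) (fun i => (P i).pol))

/-- The abelian scheme of the glued triple is the glued family `⋃ Aᵢ → A⁰` of the cocycle datum (definitional).
[cite: StacksProject, Tag 01LH] -/
theorem glueTripleOfTriples_A :
    (glueTripleOfTriples P θ θhat R hΩ hcoc D₀ hδ).A = (cocycleDatumOfTriples P θ θhat R hΩ hcoc).abelianScheme := rfl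

/-- The dual abelian scheme of the glued triple is the given `Ẑ` (definitional: `D₀.normalize.hat = D₀.hat`).
[cite: MilneAV2008, I §8 pp. 36–37] -/
theorem glueTripleOfTriples_D_hat :
    (glueTripleOfTriples P θ θhat R hΩ hcoc D₀ hδ).D.hat = D₀.hat := rfl

/-- **CARTESIAN CHARTS: every slice triple `Pᵢ` IS the pull-back of the glued triple along `Uᵢ ↪ A⁰`**, via the chart
`ιᵢ : Aᵢ ↪ ⋃ Aᵢ` and the dual transport `Ĝᵢ` — all five clauses of ★ `PolarizedAbelianSchemeWithLevel.IsBaseChangeVia`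
(★ FILE H `isBaseChangeVia_chartTriple_normalize`; the reassembled `chartTriple … i` is `P i` by structure eta).
[cite: MumfordFogartyKirwan1994, Ch. 7 §2 Definition 7.2 (p. 129)] [cite: StacksProject, Tag 01LH] -/
theorem isBaseChangeVia_glueTripleOfTriples (i : D.J) :
    (P i).IsBaseChangeVia (glueTripleOfTriples P θ θhat R hΩ hcoc D₀ hδ) (D.ι i)
      ((cocycleDatumOfTriples P θ θhat R hΩ hcoc).total.ι i)
      ((cocycleDatumOfTriples P θ θhat R hΩ hcoc).Ĝ (fun i => (P i).D) (fun i => (P i).pol) θhat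
        (fun i j => (R i j).2.2.1) (fun i j => (R i j).2.2.2) D₀.normalize i) :=
  (cocycleDatumOfTriples P θ θhat R hΩ hcoc).isBaseChangeVia_chartTriple_normalize (fun i => (P i).D)
    (fun i => (P i).pol) θhat (fun i j => (R i j).2.2.1) (fun i j => (R i j).2.2.2) D₀ (fun i => (P i).level)
    (fun i j => (R i j).1) (fun i => (P i).relDim) hδ (fun i => (P i).hasType) (fun i => (P i).symplectic) i

end PolarizedAbelianSchemeWithLevel

end Literature.AlgebraicGeometry.AbelianSchemes

end
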